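import Summits.Parity.GeneralizedHardyLittlewood.Theorems.TypeI2Dilated.Negative.LogPowerBias

/-!
# `TypeI2Dilated` (stmt-Parity-14272): structure, monotonicity and boundary refutations (refuter)

Support file for the crux `Summit.Parity.GeneralizedHardyLittlewood.Theses.LiouvilleShiftedTables.TypeI2Dilated`
(X2 of route LiouvilleShiftedTables), continuing `Negative/LogPowerBias.lean` (which defines the
generic shape `TypeI2DilatedFor`).

* Monotonicity API (positive bookkeeping provers may import): `lhs`, `lhs_nonneg`, `lhs_mono_Q`,
  `BoundAt`, `typeI2DilatedFor_iff_boundAt` (`Iff.rfl`), `BoundAt.mono_rho`,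
  `TypeI2DilatedFor.exists_rho_le` (`∃ ρ` means "all small `ρ`"), `lhs_single_le` (the `ℓ¹` form
  dominates each single dilation, e.g. the undilated `q = 1` slice).
* Structure of the summand: `summand_factor_at_c_zero` / `inner_factor_at_c_zero` (`c = 0` is
  Bombieri–Vinogradov for `λ`: `c ≠ 0` is not load-bearing for X2), `glue_class_iff_dvd` +
  `liouville_of_dvd` (the glue slice `w = h = -c`: `q ∣ m + c`, rational residue `c q̄ (mod rs)`),
  `inner_w0_undilate` (the class `w = 0`, `(q, rs) = 1`, IS the undilated Fouvry–Tenenbaum inner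
  sum with `r ↦ rq`).
* Boundary refutations: `not_typeI2DilatedUniformC_liouville` (`∃ C ∀ A` is false),
  `not_typeI2DilatedNoLevel_liouville` (no level constraint at all is false: one-term sums).

Extracted from the disprover's work file `Disproof.lean` (evidence on stmt-Parity-14272).
-/

namespace Summit.Parity.GeneralizedHardyLittlewood.Cruxes.TypeI2Dilated.Negative

open Finset Real

/-! ### Monotonicity in `ρ` and the single-dilation slice -/

/-- The left-hand side of the crux inequality (dilations `q ≤ Q`). -/
noncomputable def lhs (f : ℕ → ℝ) (c : ℤ) (Q w : ℕ) (R S y : ℝ) : ℝ :=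
  ∑ q ∈ Finset.Icc 1 Q, ∑ r ∈ Finset.Icc 1 ⌊R⌋₊, |∑ s ∈ Finset.Icc 1 ⌊S⌋₊,
    ∑ n ∈ (Finset.Icc 1 ⌊y / (s * r)⌋₊).filter (fun n : ℕ => r * s * n ≡ w [MOD q]),
      f (Int.toNat ((r : ℤ) * s * n + c))|

/-- `lhs ≥ 0` (a sum of absolute values). -/
theorem lhs_nonneg (f : ℕ → ℝ) (c : ℤ) (Q w : ℕ) (R S y : ℝ) : 0 ≤ lhs f c Q w R S y :=
  Finset.sum_nonneg fun _ _ => Finset.sum_nonneg fun _ _ => abs_nonneg _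

/-- `lhs` is monotone in the dilation range `Q`. -/
theorem lhs_mono_Q (f : ℕ → ℝ) (c : ℤ) {Q Q' : ℕ} (h : Q ≤ Q') (w : ℕ) (R S y : ℝ) :
    lhs f c Q w R S y ≤ lhs f c Q' w R S y := by
  unfold lhs
  refine Finset.sum_le_sum_of_subset_of_nonneg (Finset.Icc_subset_Icc le_rfl h) ?_
  intro q _ _
  exact Finset.sum_nonneg fun _ _ => abs_nonneg _

/-- The crux bound at fixed data `(c, ρ, A, C, x₀)`. -/
def BoundAt (f : ℕ → ℝ) (c : ℤ) (ρ A C x₀ : ℝ) : Prop :=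
  ∀ x : ℝ, x₀ ≤ x → ∀ w : ℕ, ∀ R S y : ℝ, 1 ≤ R → R ≤ x ^ ρ → 0 ≤ S → S * R ≤ x ^ (1 / 2 + ρ) →
    0 ≤ y → y ≤ x → lhs f c ⌊x ^ ρ⌋₊ w R S y ≤ C * x / Real.log x ^ A

/-- The crux shape in terms of `BoundAt` (definitional). -/
theorem typeI2DilatedFor_iff_boundAt (f : ℕ → ℝ) :
    TypeI2DilatedFor f ↔ ∀ c : ℤ, c ≠ 0 → ∃ ρ : ℝ, 0 < ρ ∧ ∀ A : ℝ, 0 < A → ∃ C x₀ : ℝ,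
      BoundAt f c ρ A C x₀ := Iff.rfl

/-- **Monotonicity in `ρ`.** A smaller `ρ` means fewer dilations, a shorter `r`-range and a lower
level, so the bound for `ρ` implies the bound for every `ρ' ∈ (0, ρ]` (from `x ≥ 1` on). -/
theorem BoundAt.mono_rho {f : ℕ → ℝ} {c : ℤ} {ρ ρ' A C x₀ : ℝ} (h : BoundAt f c ρ A C x₀)
    (hle : ρ' ≤ ρ) : BoundAt f c ρ' A C (max x₀ 1) := by
  intro x hx w R S y hR1 hRx hS0 hSR hy0 hyx
  have hx₀ : x₀ ≤ x := (le_max_left _ _).trans hx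
  have hx1 : (1 : ℝ) ≤ x := (le_max_right _ _).trans hx
  have hpow : x ^ ρ' ≤ x ^ ρ := Real.rpow_le_rpow_of_exponent_le hx1 hle
  have hpow' : x ^ (1 / 2 + ρ') ≤ x ^ (1 / 2 + ρ) :=
    Real.rpow_le_rpow_of_exponent_le hx1 (by linarith)
  have h1 := h x hx₀ w R S y hR1 (hRx.trans hpow) hS0 (hSR.trans hpow') hy0 hyx
  exact (lhs_mono_Q f c (Nat.floor_mono hpow) w R S y).trans h1

/-- Hence `∃ ρ` in the crux means "for all sufficiently small `ρ`": provers may take `ρ` below any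
threshold they need (e.g. `ρ < 1/105` for Fouvry–Tenenbaum's Theorem 1.5, or below the `δ(η)` of a
dispersion estimate), as the glue `SieveToMAvg` already assumes. -/
theorem TypeI2DilatedFor.exists_rho_le {f : ℕ → ℝ} (h : TypeI2DilatedFor f) {c : ℤ} (hc : c ≠ 0)
    {ρ₀ : ℝ} (hρ₀ : 0 < ρ₀) :
    ∃ ρ : ℝ, 0 < ρ ∧ ρ ≤ ρ₀ ∧ ∀ A : ℝ, 0 < A → ∃ C x₀ : ℝ, BoundAt f c ρ A C x₀ := by
  obtain ⟨ρ, hρ, hA⟩ := (typeI2DilatedFor_iff_boundAt f).1 h c hc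
  refine ⟨min ρ ρ₀, lt_min hρ hρ₀, min_le_right _ _, fun A hApos => ?_⟩
  obtain ⟨C, x₀, hB⟩ := hA A hApos
  exact ⟨C, max x₀ 1, hB.mono_rho (min_le_left _ _)⟩

/-- The `ℓ¹`-form dominates every single dilation: the bound for the sum over `q ≤ x^ρ` gives the
same bound for each individual `q₀ ≤ x^ρ` (in particular `q₀ = 1`, the undilated
Fouvry–Tenenbaum shape). -/
theorem lhs_single_le {f : ℕ → ℝ} {c : ℤ} {Q q₀ : ℕ} (hq₀ : 1 ≤ q₀) (hq₀Q : q₀ ≤ Q) (w : ℕ)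
    (R S y : ℝ) :
    ∑ r ∈ Finset.Icc 1 ⌊R⌋₊, |∑ s ∈ Finset.Icc 1 ⌊S⌋₊,
      ∑ n ∈ (Finset.Icc 1 ⌊y / (s * r)⌋₊).filter (fun n : ℕ => r * s * n ≡ w [MOD q₀]),
        f (Int.toNat ((r : ℤ) * s * n + c))| ≤ lhs f c Q w R S y := by
  unfold lhs
  exact Finset.single_le_sum (s := Finset.Icc 1 Q)
    (f := fun q => ∑ r ∈ Finset.Icc 1 ⌊R⌋₊, |∑ s ∈ Finset.Icc 1 ⌊S⌋₊,
      ∑ n ∈ (Finset.Icc 1 ⌊y / (s * r)⌋₊).filter (fun n : ℕ => r * s * n ≡ w [MOD q]),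
        f (Int.toNat ((r : ℤ) * s * n + c))|)
    (fun q _ => Finset.sum_nonneg fun _ _ => abs_nonneg _) (Finset.mem_Icc.2 ⟨hq₀, hq₀Q⟩)

/-! ### Structure of the summand: `c = 0`, the glue slice `w + c ≡ 0`, and the class `w = 0` -/

/-- **`c ≠ 0` is not load-bearing for X2.** At `c = 0` the summand factors through complete
multiplicativity, `λ(r s n) = λ(r) λ(s) λ(n)`, so the inner sum is `λ(r) λ(s) · ∑_{n, rsn ≡ w (q)} λ(n)`:
a sum of `λ` over `n ≤ y/(rs)` in a union of classes modulo `q / gcd(q, rs) ≤ x^ρ`, which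
Bombieri–Vinogradov for `λ` (moduli `≤ x^{1/2-ε}`, in print: Fouvry–Tenenbaum Thm 1.8; tree:
`Literature.NumberTheory.Sieve.FouvryTenenbaum2021_thm18_liouville`) bounds on `ℓ¹`-average over
`q, r, s` with absolute values everywhere. So the `c = 0` variant of X2 is TRUE and no disproof can
come from the `c`-aspect (contrast: for X1 = `TableChowla`, `c = 0` gives a rank-one table). -/
theorem summand_factor_at_c_zero (r s n : ℕ) :
    (ArithmeticFunction.liouville (Int.toNat ((r : ℤ) * s * n + 0)) : ℝ) =
      (ArithmeticFunction.liouville r : ℝ) * (ArithmeticFunction.liouville s : ℝ) *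
        (ArithmeticFunction.liouville n : ℝ) := by
  have h : ((r : ℤ) * s * n + 0) = ((r * s * n : ℕ) : ℤ) := by push_cast; ring
  rw [h, Int.toNat_natCast, ArithmeticFunction.liouville_apply_mul,
    ArithmeticFunction.liouville_apply_mul]
  push_cast; ring

/-- At `c = 0` the class-restricted inner sum is `λ(r) λ(s) · ∑_{n, rsn ≡ w (q)} λ(n)`. -/
theorem inner_factor_at_c_zero (q w r s N : ℕ) :
    ∑ n ∈ (Finset.Icc 1 N).filter (fun n : ℕ => r * s * n ≡ w [MOD q]),
        (ArithmeticFunction.liouville (Int.toNat ((r : ℤ) * s * n + 0)) : ℝ) =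
      (ArithmeticFunction.liouville r : ℝ) * (ArithmeticFunction.liouville s : ℝ) *
        ∑ n ∈ (Finset.Icc 1 N).filter (fun n : ℕ => r * s * n ≡ w [MOD q]),
          (ArithmeticFunction.liouville n : ℝ) := by
  rw [Finset.mul_sum]
  exact Finset.sum_congr rfl fun n _ => summand_factor_at_c_zero r s n

/-- **The glue slice.** `SieveToMAvg` consumes X2 only at `c = -h`, `w = h` (`h ≥ 1` the prime
shift), where the class condition says `q ∣ m + c` for `m = r s n`: -/
theorem glue_class_iff_dvd (q m h : ℕ) :
    m ≡ h [MOD q] ↔ (q : ℤ) ∣ (m : ℤ) + (-(h : ℤ)) := by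
  rw [Nat.modEq_iff_dvd, ← sub_eq_add_neg, dvd_sub_comm]

/-- … and on that slice `λ(m + c) = λ(q) · λ((m + c)/q)`: the glue slice of X2 is `λ` along the
MULTIPLES of `q` inside the progression `c mod rs` with the truncated-divisor weight — after
dividing by `q`, a Fouvry–Tenenbaum sum at height `y/q` in the class `c · q̄ (mod rs)`, i.e. a
RATIONAL residue `a₁ \overline{a₂}` with `|a₁| = |c|`, `a₂ = q ≤ x^ρ` (the uniformity of
Bombieri–Friedlander–Iwaniec Thm 5*/Drappeau 2017 Thm 5.1, not a fixed integer residue). -/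
theorem liouville_of_dvd {q m : ℕ} (h : q ∣ m) :
    (ArithmeticFunction.liouville m : ℝ) =
      (ArithmeticFunction.liouville q : ℝ) * (ArithmeticFunction.liouville (m / q) : ℝ) := by
  conv_lhs => rw [← Nat.mul_div_cancel' h]
  rw [ArithmeticFunction.liouville_apply_mul]; push_cast; ring

/-- **The class `w = 0` is the undilated (printed) shape.** For `(q, rs) = 1` the condition
`r s n ≡ 0 (mod q)` is `q ∣ n`, and re-indexing `n = q k` turns the dilated inner sum into the
UNDILATED inner sum with `r` replaced by `r q`:
so `∑_{q ≤ x^ρ} ∑_{r ≤ R} |inner_q(r)|` at `w = 0` (coprime part) is a sum over moduli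
`d = r q ≤ R x^ρ ≤ x^{2ρ}` — with multiplicity `≤ τ(d)` — of the Fouvry–Tenenbaum quantity
(Thm 1.5 needs `d ≤ x^{1/105-ε}`: take `ρ < 1/210`). The genuinely new content of X2 is therefore
the classes `w ≢ 0 (mod q)`, i.e. a character twist `χ (mod q)` of the F–T sum on `ℓ¹`-average
over `q ≤ x^ρ`. -/
theorem inner_w0_undilate (f : ℕ → ℝ) (c : ℤ) {q : ℕ} (r s : ℕ) (hq : 1 ≤ q)
    (hcop : Nat.Coprime q (r * s)) (y : ℝ) :
    ∑ n ∈ (Finset.Icc 1 ⌊y / (s * r)⌋₊).filter (fun n : ℕ => r * s * n ≡ 0 [MOD q]),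
        f (Int.toNat ((r : ℤ) * s * n + c)) =
      ∑ k ∈ Finset.Icc 1 ⌊y / (s * ((r * q : ℕ) : ℝ))⌋₊,
        f (Int.toNat (((r * q : ℕ) : ℤ) * s * k + c)) := by
  have hq0 : 0 < q := hq
  -- the class condition is `q ∣ n`
  have hfilt : (Finset.Icc 1 ⌊y / (s * r)⌋₊).filter (fun n : ℕ => r * s * n ≡ 0 [MOD q]) =
      (Finset.Icc 1 ⌊y / (s * r)⌋₊).filter (fun n : ℕ => q ∣ n) := by
    refine Finset.filter_congr (fun n _ => ?_)
    rw [Nat.modEq_zero_iff_dvd]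
    exact ⟨fun h => hcop.dvd_of_dvd_mul_left (by simpa [mul_comm, mul_assoc] using h),
      fun h => h.trans (Dvd.intro_left _ rfl)⟩
  rw [hfilt]
  -- the floor identity `⌊y/(sr)⌋ / q = ⌊y/(s r q)⌋`
  have hfloor : ⌊y / (s * ((r * q : ℕ) : ℝ))⌋₊ = ⌊y / (s * r)⌋₊ / q := by
    rw [← Nat.floor_div_natCast]
    congr 1
    push_cast
    rw [div_div]
    ring_nf
  rw [hfloor]
  -- re-index `n = q k`
  refine Finset.sum_bij' (fun n _ => n / q) (fun k _ => q * k) ?_ ?_ ?_ ?_ ?_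
  · intro n hn
    rw [Finset.mem_filter, Finset.mem_Icc] at hn
    rw [Finset.mem_Icc]
    refine ⟨?_, Nat.div_le_div_right hn.1.2⟩
    exact Nat.div_pos (Nat.le_of_dvd (by omega) hn.2) hq0
  · intro k hk
    rw [Finset.mem_Icc] at hk
    rw [Finset.mem_filter, Finset.mem_Icc]
    refine ⟨⟨?_, ?_⟩, Dvd.intro k rfl⟩
    · calc 1 ≤ k := hk.1
        _ ≤ q * k := Nat.le_mul_of_pos_left k hq0
    · calc q * k ≤ q * (⌊y / (s * r)⌋₊ / q) := Nat.mul_le_mul_left q hk.2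
        _ ≤ ⌊y / (s * r)⌋₊ := Nat.mul_div_le _ _
  · intro n hn
    rw [Finset.mem_filter] at hn
    exact Nat.mul_div_cancel' hn.2
  · intro k _
    exact Nat.mul_div_cancel_left k hq0
  · intro n hn
    rw [Finset.mem_filter] at hn
    congr 1
    obtain ⟨k, hk⟩ := hn.2
    subst hk
    rw [Nat.mul_div_cancel_left k hq0]
    push_cast
    ring

/-! ### Two cheap boundary refutations: the `∃ C ∀ A` order, and no level constraint at all -/

/-- `|λ n| = 1` for `n ≠ 0`. [folklore] -/
theorem abs_liouville_eq_one {n : ℕ} (hn : n ≠ 0) :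
    |(ArithmeticFunction.liouville n : ℝ)| = 1 := by
  rw [ArithmeticFunction.liouville_apply hn]; push_cast
  rw [abs_pow, abs_neg, abs_one, one_pow]

/-- The single-dilation expression at `q₀ = 1`, `R = S = 1`, `y = 1`, `c = 1` is `|λ 2| = 1`. -/
theorem slice_one_one_one :
    ∑ r ∈ Finset.Icc 1 ⌊(1 : ℝ)⌋₊, |∑ s ∈ Finset.Icc 1 ⌊(1 : ℝ)⌋₊,
      ∑ n ∈ (Finset.Icc 1 ⌊(1 : ℝ) / (s * r)⌋₊).filter (fun n : ℕ => r * s * n ≡ 1 [MOD 1]),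
        (ArithmeticFunction.liouville (Int.toNat ((r : ℤ) * s * n + 1)) : ℝ)| = 1 := by
  simp only [Nat.floor_one, Finset.Icc_self, Finset.sum_singleton, Nat.cast_one, one_mul,
    div_one]
  rw [Finset.filter_true_of_mem (fun n _ => Nat.modEq_one)]
  simp only [Finset.sum_singleton, Nat.cast_one]
  have h2 : Int.toNat ((1 : ℤ) + 1) = 2 := by decide
  rw [h2]
  exact abs_liouville_eq_one two_ne_zero

/-- The crux with the constant `C` chosen BEFORE `A` (`∃ C x₀, ∀ A > 0`). -/
def TypeI2DilatedUniformC (f : ℕ → ℝ) : Prop :=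
  ∀ c : ℤ, c ≠ 0 → ∃ ρ : ℝ, 0 < ρ ∧ ∃ C x₀ : ℝ, ∀ A : ℝ, 0 < A → BoundAt f c ρ A C x₀

/-- **The `∀ A ∃ C` order cannot be improved** (trivial, recorded so nobody files it): with `C` fixed,
`C x / (log x)^A → 0` as `A → ∞` at fixed `x ≥ 3`, while the left side is `≥ |λ 2| = 1`
(`c = 1`, `w = 1`, `R = S = y = 1`, dilation `q = 1`). -/
theorem not_typeI2DilatedUniformC_liouville :
    ¬ TypeI2DilatedUniformC (fun n => (ArithmeticFunction.liouville n : ℝ)) := by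
  intro h
  obtain ⟨ρ, hρ, C, x₀, hA⟩ := h 1 one_ne_zero
  obtain ⟨N, hN⟩ := exists_nat_ge (max x₀ 3)
  have hx₀ : x₀ ≤ (N : ℝ) := (le_max_left _ _).trans hN
  have h3N : (3 : ℝ) ≤ N := (le_max_right _ _).trans hN
  have hNpos : (0 : ℝ) < N := by linarith
  have hlog : 1 < Real.log N := by
    rw [← Real.log_exp 1]
    refine Real.log_lt_log (Real.exp_pos 1) ?_
    have := Real.exp_one_lt_d9
    linarith
  -- choose a natural exponent `n ≥ 1` with `C N < (log N)^n`
  obtain ⟨n, hn1, hnC⟩ : ∃ n : ℕ, 1 ≤ n ∧ C * N < Real.log N ^ n := by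
    have hev := ((tendsto_pow_atTop_atTop_of_one_lt hlog).eventually_gt_atTop (C * N)).and
      (Filter.eventually_ge_atTop 1)
    obtain ⟨n, hn⟩ := hev.exists
    exact ⟨n, hn.2, hn.1⟩
  have hB := hA n (by exact_mod_cast hn1) N hx₀ 1 1 1 1 le_rfl
    (Real.one_le_rpow (by linarith) hρ.le) zero_le_one
    (by rw [one_mul]; exact Real.one_le_rpow (by linarith) (by positivity)) zero_le_one (by linarith)
  -- left side ≥ the `q = 1` slice = 1
  have hQ : 1 ≤ ⌊(N : ℝ) ^ ρ⌋₊ := Nat.le_floor (by simpa using Real.one_le_rpow (by linarith : (1:ℝ) ≤ N) hρ.le)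
  have hslice := lhs_single_le (f := fun n => (ArithmeticFunction.liouville n : ℝ)) (c := 1)
    le_rfl hQ 1 1 1 1
  rw [slice_one_one_one] at hslice
  -- right side < 1
  have hlogpow : 0 < Real.log N ^ (n : ℝ) := by positivity
  have hR : C * N / Real.log N ^ (n : ℝ) < 1 := by
    rw [div_lt_one hlogpow, Real.rpow_natCast]
    exact hnC
  linarith [hslice.trans hB]

/-- The crux with BOTH level constraints (`R ≤ x^ρ`, `S R ≤ x^{1/2+ρ}`) removed. -/
def TypeI2DilatedNoLevel (f : ℕ → ℝ) : Prop :=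
  ∀ c : ℤ, c ≠ 0 → ∃ ρ : ℝ, 0 < ρ ∧ ∀ A : ℝ, 0 < A → ∃ C x₀ : ℝ, ∀ x : ℝ, x₀ ≤ x → ∀ w : ℕ,
    ∀ R S y : ℝ, 1 ≤ R → 0 ≤ S → 0 ≤ y → y ≤ x →
      lhs f c ⌊x ^ ρ⌋₊ w R S y ≤ C * x / Real.log x ^ A

/-- For `N/2 < r ≤ N` the range `n ≤ N/r` is the single point `n = 1`. [folklore] -/
theorem floor_div_eq_one {N r : ℕ} (h1 : N / 2 < r) (h2 : r ≤ N) :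
    ⌊(N : ℝ) / r⌋₊ = 1 := by
  rw [Nat.floor_div_eq_div]
  refine Nat.div_eq_of_lt_le (by omega) ?_
  omega

/-- **No level at all is trivially false** (recorded so nobody files it): with `R = y = x = N`,
`S = 1`, `w = 0`, dilation `q = 1`, every `r ∈ (N/2, N]` contributes the single term
`|λ(r + 1)| = 1`, so the left side is `≥ N/2 > C N / log N`. The level hypotheses are where the
statement's content sits: dropping only ONE of them leaves an Elliott–Halberstam-type statement
for `λ` (outer absolute modulus `≤ x^{1/2+ρ}`), conjecturally true and not refutable here. -/
theorem not_typeI2DilatedNoLevel_liouville :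
    ¬ TypeI2DilatedNoLevel (fun n => (ArithmeticFunction.liouville n : ℝ)) := by
  intro h
  obtain ⟨ρ, hρ, hA⟩ := h 1 one_ne_zero
  obtain ⟨C, x₀, hx⟩ := hA 1 one_pos
  set C' := max C 0 with hC'def
  have hC'0 : 0 ≤ C' := le_max_right _ _
  have hCC' : C ≤ C' := le_max_left _ _
  obtain ⟨N, hN⟩ := exists_nat_ge (max (max x₀ 3) (Real.exp (4 * C')))
  have hx₀ : x₀ ≤ (N : ℝ) := ((le_max_left _ _).trans (le_max_left _ _)).trans hN
  have h3N : (3 : ℝ) ≤ N := ((le_max_right _ _).trans (le_max_left _ _)).trans hN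
  have heN : Real.exp (4 * C') ≤ N := (le_max_right _ _).trans hN
  have hNpos : (0 : ℝ) < N := by linarith
  have hB := hx N hx₀ 0 N 1 N (by linarith) zero_le_one (Nat.cast_nonneg N) le_rfl
  -- `q = 1` slice
  have hQ : 1 ≤ ⌊(N : ℝ) ^ ρ⌋₊ :=
    Nat.le_floor (by simpa using Real.one_le_rpow (by linarith : (1:ℝ) ≤ N) hρ.le)
  have hslice := lhs_single_le (f := fun n => (ArithmeticFunction.liouville n : ℝ)) (c := 1)
    le_rfl hQ 0 (N : ℝ) 1 (N : ℝ)
  -- evaluate the slice from below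
  have hterm : ∀ r ∈ Finset.Ioc (N / 2) N,
      |∑ s ∈ Finset.Icc 1 ⌊(1 : ℝ)⌋₊,
        ∑ n ∈ (Finset.Icc 1 ⌊(N : ℝ) / (s * r)⌋₊).filter (fun n : ℕ => r * s * n ≡ 0 [MOD 1]),
          (ArithmeticFunction.liouville (Int.toNat ((r : ℤ) * s * n + 1)) : ℝ)| = 1 := by
    intro r hr
    rw [Finset.mem_Ioc] at hr
    simp only [Nat.floor_one, Finset.Icc_self, Finset.sum_singleton, Nat.cast_one, one_mul,
      mul_one]
    rw [Finset.filter_true_of_mem (fun n _ => Nat.modEq_one), floor_div_eq_one hr.1 hr.2]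
    simp only [Finset.Icc_self, Finset.sum_singleton, Nat.cast_one, mul_one]
    have h2 : Int.toNat ((r : ℤ) + 1) = r + 1 := by omega
    rw [h2]
    exact abs_liouville_eq_one (Nat.succ_ne_zero r)
  have hsub : Finset.Ioc (N / 2) N ⊆ Finset.Icc 1 ⌊(N : ℝ)⌋₊ := by
    rw [Nat.floor_natCast]
    intro r hr
    rw [Finset.mem_Ioc] at hr
    rw [Finset.mem_Icc]
    omega
  have hlow : ((N - N / 2 : ℕ) : ℝ) ≤ lhs (fun n => (ArithmeticFunction.liouville n : ℝ)) 1
      ⌊(N : ℝ) ^ ρ⌋₊ 0 (N : ℝ) 1 (N : ℝ) := by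
    refine le_trans ?_ hslice
    refine le_trans ?_ (Finset.sum_le_sum_of_subset_of_nonneg hsub (fun _ _ _ => abs_nonneg _))
    rw [Finset.sum_congr rfl hterm, Finset.sum_const, nsmul_eq_mul, mul_one, Nat.card_Ioc]
  have hhalf : (N : ℝ) / 2 ≤ ((N - N / 2 : ℕ) : ℝ) := by
    have h1 : ((N / 2 : ℕ) : ℝ) ≤ (N : ℝ) / 2 := Nat.cast_div_le
    have h2 : N / 2 ≤ N := Nat.div_le_self _ _
    push_cast [Nat.cast_sub h2]
    linarith
  -- right side: C N / log N ≤ C' N / log N ≤ N / 4 < N / 2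
  have hlogpos : 0 < Real.log N := Real.log_pos (by linarith)
  have hlog4 : 4 * C' ≤ Real.log N := by
    calc 4 * C' = Real.log (Real.exp (4 * C')) := (Real.log_exp _).symm
      _ ≤ Real.log N := Real.log_le_log (Real.exp_pos _) heN
  have hR : C * N / Real.log N ^ (1 : ℝ) ≤ N / 4 := by
    rw [Real.rpow_one, div_le_iff₀ hlogpos]
    calc C * N ≤ C' * N := mul_le_mul_of_nonneg_right hCC' hNpos.le
      _ = N / 4 * (4 * C') := by ring
      _ ≤ N / 4 * Real.log N := mul_le_mul_of_nonneg_left hlog4 (by positivity)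
  linarith [hlow.trans hB]

end Summit.Parity.GeneralizedHardyLittlewood.Cruxes.TypeI2Dilated.Negative
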